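import Summits.BirchSwinnertonDyer.BirchSwinnertonDyer.Theorems.ErratumRoadFiveIMCDivUnitValue
import HarnessLib

/-!
# Route `ErratumRoadFive` (rung K2, `p ≥ 5`), crux `IMCDivAtErratumDataAll` (item stmt-BirchSwinnertonDyer-19270, H3♭):
# the crux's shapes RESTRICTED TO ONE ERRATUM DISCRIMINANT (DEFINITIONS) and a slice from print + a unit certificate

Cell `bsd-stepL` (run/shared/lean/pub/bsd-stepL/), seat `bsd-stepL-imc-p1` (prover g6, 2026-08-26); `--supports
stmt-BirchSwinnertonDyer-19270 --as helper`; Theses-free (imports only X11b library modules and the Theses-free Theorems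
file `ErratumRoadFiveIMCDivUnitValue`), so it is importable by skeletons, rung files and `closes` terms alike.

WHY. Crux 19270 asks `P2.IMCDivIntCoreFrameAtErratumData W p` (file `X11b/BDPRouteErratumData.lean`) at EVERY erratum
datum of the pair `(W, p)`. Its certified rungs are necessarily PER DISCRIMINANT (imc-p1 g5, evidence
`RUNG-19270-5235a1-imc-p1-g5.md` on the item: the printed BDP value `u·((1 − a_p p⁻¹)·log_ω y_K)²` depends on the erratum
field `K`, so a finite certificate can only speak about the data over the fields of ONE discriminant `d`). Planner g26
re-typed the crux's BC5 rung accordingly (`stub_rung_imcDivErratum_5235a1_d231`, skeleton v2, 2026-08-26T15:14Z) by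
displaying the per-discriminant statement and the unit certificate IN FULL — 3 947 characters after whitespace
normalisation, which the ledger's stub registry TRUNCATES at 3 900, so no file can match the registered signature by name
(p457440 bounced `supports.stub-mismatch` on a verbatim copy). This file gives the two displayed crux-slices NAMES, so that the
rung (and any later per-discriminant rung of this crux, at any pair) has a registrable signature well under the cap:

* `P2.IMCDivIntFrameAtDiscr W p d` ∕ **`P2.IMCDivIntCoreFrameAtDiscr W p d`** (`@[conjecture]`: open slices of the crux)
  — the bodies of `P2.IMCDivIntFrameAtErratumData W p` ∕ `P2.IMCDivIntCoreFrameAtErratumData W p` VERBATIM with the ONE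
  extra binder `NumberField.discr K = d →` (after `IsErratumField W K q →`); §2: `…AtErratumData W p ↔ ∀ d, …AtDiscr W p d`.
* §3 **`P2.imcDivInt[Core]FrameAtDiscr_of_thm32_of_unitCertAtDiscr`** — on a SEMISTABLE pair, Castella 2018 Thms. 3.1–3.2
  (`h32`, PUBLISHED named fact) + the DISPLAYED unit-value certificate at `d` («at every erratum datum of `(W, p)` over a
  field of discriminant `d`, `‖(1 − a_p p⁻¹)·log_ω P‖_p = 1»; an ATTESTABLE finite statement about one curve and the Heegner
  points of level `N_E` over `ℚ(√d)`, never a theorem of the tree — kit j255217 for `(5235a1, 5, −231)`) ⟹ the slice at `d`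
  (the printed frame is a unit of `𝓞_{ℂ_p}⟦T⟧` at a unit datum, so the divisibility conjunct is trivial: imc-p1 g5's
  `P2.imcDivInt[Core]FrameAtDatum_of_thm32_of_unitValue`, datum by datum).

So the registrable form of the rung is `theorem stub_rung_imcDivErratum_5235a1_d231 [inst] [inst]
(h32 : thm32_exists_isBDPLFunction_valueAtOne) (hunit : ‹the certificate at −231, displayed as in skeleton v2›) :
P2.IMCDivIntCoreFrameAtDiscr E 5 (-231)` (`E` the literal model of `5235a1`; ≈ 2 000 characters), closed by §3 with
`Rung5235a1.semistable` (imc-p1 g5, p451721).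

HONEST FRAMING: two `@[conjecture]` definitions with bodies (open shapes; nothing asserted) and theorems; no named fact, no
instance, no notation, no `sorry`; nothing is booked; BSD is proved for no pair; the per-discriminant shape at one `d` is ONE slice of the crux
(the crux is its conjunction over all `d`, §2), and a certified slice says nothing about the other discriminants.

References: [Castella2018] Thm. 3.1, display (3.2), Thm. 3.2 (arXiv:1704.06608 p. 9); [Castella2018Erratum] (2.4) (p. 4);
[Hsieh2014] p. 7 (the receptacle); imc-p1 g5 memo RUNG-19270-5235a1-imc-p1-g5.md (evidence on item 19270).
-/

noncomputable section

open scoped Classical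

open WeierstrassCurve NumberField IsDedekindDomain Field PowerSeries
open Literature.NumberTheory.EllipticCurves Literature.NumberTheory.EllipticCurves.GreenbergSelmer
open Literature.NumberTheory.EllipticCurves.ModularForms
open Literature.NumberTheory.EllipticCurves.Rank1Residual
open Literature.NumberTheory.EllipticCurves.Rank1Residual.Typed
open Literature.NumberTheory.EllipticCurves.Castella2018
open Literature.NumberTheory.GaloisRepresentations
open Literature.NumberTheory.GaloisCohomology
open Summit.BirchSwinnertonDyer.Rank1Residual.X11b.AcSelmer
open Summit.BirchSwinnertonDyer.Rank1Residual.X11b.Halves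

namespace Summit.BirchSwinnertonDyer.Rank1Residual.X11b

/-! ### §1 The shapes at one discriminant -/

section Shape

variable (W : WeierstrassCurve ℚ) [W.IsElliptic] [W.IsGloballyMinimal] (p : ℕ) [Fact p.Prime] (d : ℤ)

/-- **(2.4)♭ ONE-SIDED WITH VALUE, AT THE ERRATUM DATA OF ONE DISCRIMINANT `d` (shape)** — the body of
`P2.IMCDivIntFrameAtErratumData W p` VERBATIM with the extra binder `NumberField.discr K = d`: at every erratum datum of
`(W, p)` over a field of discriminant `d` there is a ♭-frame `(Ω_K ≠ 0, ‖Ω_p‖ = 1, Q ∈ 𝓞_{ℂ_p}⟦T⟧)` with Castella's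
interpolation property, the value conjunct at `𝟙` and the divisibility `Ch_Λ(X_ac^∅(E[p^∞]))·𝓞_{ℂ_p}⟦T⟧ ⊆ (Q)`.
A predicate on `(W, p, d)`; nothing asserted. [claim: Castella2018Erratum, status: under-review]
[cite: Castella2018, Thm. 3.1, display (3.2) and Thm. 3.2 (arXiv:1704.06608 p. 9) (shape only; nothing asserted)] -/
@[conjecture]
def P2.IMCDivIntFrameAtDiscr : Prop :=
  ∀ [NeZero (W.conductorNorm ℤ)] (q : ℕ) [Fact q.Prime] (K : Type) [Field K] [NumberField K]
    (Dt : ModularParametrizationData W (W.conductorNorm ℤ))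
    (H : HeegnerDatum (W.conductorNorm ℤ) (NumberField.discr K)) (w₀ : InfinitePlace K)
    (P : (W.baseChange K).toAffine.Point), ErratumHypotheses W p → W.analyticRank = 1 →
    q ≠ p → Mult W q → ¬ W.HasSplitMultiplicativeReductionAtPrime q →
    ¬ p ∣ padicValInt q W.minimalDiscriminantInt → IsErratumField W K q → NumberField.discr K = d →
    Cas20Standing K p (W.conductorNorm ℤ / p) →
    WeierstrassCurve.Affine.Point.map w₀.embedding.toRatAlgHom P = heegnerPointComplex Dt H →
    ¬ (p : ℤ) ∣ Dt.c → ¬ IsOfFinAddOrder P →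
    ∀ (κ : ZpExtension K p), κ.IsAnticyclotomic →
      ∀ (γ : Field.absoluteGaloisGroup K) [Fact (κ.IsTopGenerator γ)] (ι' : PadicAlgCl p ≃+* ℂ)
        (e : K →+* ℚ_[p]),
        (∀ k : 𝓞 K, k ∈ (primeOfEmbeddingDatum p ι' w₀.embedding).asIdeal ↔ ‖e (k : K)‖ < 1) →
        ∃ (ΩK : ℂ) (Ωp : ℂ_[p]) (Q : PowerSeries 𝓞_ℂ_[p]), ΩK ≠ 0 ∧ ‖Ωp‖ = 1 ∧
          R1.IsBDPLFunctionInt p ι' (primeOfEmbeddingDatum p ι' w₀.embedding) κ γ Dt.f ΩK Ωp Q ∧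
          R1.BDPValueAtOneIntAt W p e P Q (W.LFunction p) ∧
          (XAc.charIdeal (W.baseChange K) p κ (primeOfEmbeddingDatum p ι' w₀.embedding) ∅ γ).map
              (PowerSeries.map (R1.toCpInt p)) ≤ Ideal.span {Q}

/-- **(2.4)♭ ONE-SIDED CORE (no value conjunct), AT THE ERRATUM DATA OF ONE DISCRIMINANT `d` (shape)** — the body of
`P2.IMCDivIntCoreFrameAtErratumData W p` (crux 19270's currency) VERBATIM with the extra binder `NumberField.discr K = d`.
The statement of the crux's per-discriminant rungs. A predicate on `(W, p, d)`; nothing asserted.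
[claim: Castella2018Erratum, status: under-review]
[cite: Castella2018, Thm. 3.1 and display (3.2) (arXiv:1704.06608 p. 9) (shape only; nothing asserted)] -/
@[conjecture]
def P2.IMCDivIntCoreFrameAtDiscr : Prop :=
  ∀ [NeZero (W.conductorNorm ℤ)] (q : ℕ) [Fact q.Prime] (K : Type) [Field K] [NumberField K]
    (Dt : ModularParametrizationData W (W.conductorNorm ℤ))
    (H : HeegnerDatum (W.conductorNorm ℤ) (NumberField.discr K)) (w₀ : InfinitePlace K)
    (P : (W.baseChange K).toAffine.Point), ErratumHypotheses W p → W.analyticRank = 1 →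
    q ≠ p → Mult W q → ¬ W.HasSplitMultiplicativeReductionAtPrime q →
    ¬ p ∣ padicValInt q W.minimalDiscriminantInt → IsErratumField W K q → NumberField.discr K = d →
    Cas20Standing K p (W.conductorNorm ℤ / p) →
    WeierstrassCurve.Affine.Point.map w₀.embedding.toRatAlgHom P = heegnerPointComplex Dt H →
    ¬ (p : ℤ) ∣ Dt.c → ¬ IsOfFinAddOrder P →
    ∀ (κ : ZpExtension K p), κ.IsAnticyclotomic →
      ∀ (γ : Field.absoluteGaloisGroup K) [Fact (κ.IsTopGenerator γ)] (ι' : PadicAlgCl p ≃+* ℂ)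
        (e : K →+* ℚ_[p]),
        (∀ k : 𝓞 K, k ∈ (primeOfEmbeddingDatum p ι' w₀.embedding).asIdeal ↔ ‖e (k : K)‖ < 1) →
        ∃ (ΩK : ℂ) (Ωp : ℂ_[p]) (Q : PowerSeries 𝓞_ℂ_[p]), ΩK ≠ 0 ∧ ‖Ωp‖ = 1 ∧
          R1.IsBDPLFunctionInt p ι' (primeOfEmbeddingDatum p ι' w₀.embedding) κ γ Dt.f ΩK Ωp Q ∧
          (XAc.charIdeal (W.baseChange K) p κ (primeOfEmbeddingDatum p ι' w₀.embedding) ∅ γ).map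
              (PowerSeries.map (R1.toCpInt p)) ≤ Ideal.span {Q}

end Shape

/-! ### §2 Bookkeeping: the crux's shapes are the conjunction of their slices over all discriminants -/

section Slices

variable {W : WeierstrassCurve ℚ} [W.IsElliptic] [W.IsGloballyMinimal] {p : ℕ} [Fact p.Prime]

omit [W.IsElliptic] in
/-- The crux's core shape gives its slice at every discriminant. [folklore] -/
theorem P2.imcDivIntCoreFrameAtDiscr_of_atErratumData (h : P2.IMCDivIntCoreFrameAtErratumData W p) (d : ℤ) :
    P2.IMCDivIntCoreFrameAtDiscr W p d := by
  intro _ q _ K _ _ Dt H w₀ P hE hr hqp hmq hns hvq hK _hd hCas hP hc hinf κ hκ γ _ ι' e he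
  exact h q K Dt H w₀ P hE hr hqp hmq hns hvq hK hCas hP hc hinf κ hκ γ ι' e he

omit [W.IsElliptic] in
/-- The slices at all discriminants give the crux's core shape (`d := discr K`). [folklore] -/
theorem P2.imcDivIntCoreFrameAtErratumData_of_forall_atDiscr (h : ∀ d : ℤ, P2.IMCDivIntCoreFrameAtDiscr W p d) :
    P2.IMCDivIntCoreFrameAtErratumData W p := by
  intro _ q _ K _ _ Dt H w₀ P hE hr hqp hmq hns hvq hK hCas hP hc hinf κ hκ γ _ ι' e he
  exact h (NumberField.discr K) q K Dt H w₀ P hE hr hqp hmq hns hvq hK rfl hCas hP hc hinf κ hκ γ ι' e he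

omit [W.IsElliptic] in
/-- **Crux 19270's core shape at a pair ⟺ its per-discriminant slices at every `d`.** [folklore] -/
theorem P2.imcDivIntCoreFrameAtErratumData_iff_forall_atDiscr :
    P2.IMCDivIntCoreFrameAtErratumData W p ↔ ∀ d : ℤ, P2.IMCDivIntCoreFrameAtDiscr W p d :=
  ⟨P2.imcDivIntCoreFrameAtDiscr_of_atErratumData, P2.imcDivIntCoreFrameAtErratumData_of_forall_atDiscr⟩

/-- The with-value shape gives its slice at every discriminant. [folklore] -/
theorem P2.imcDivIntFrameAtDiscr_of_atErratumData (h : P2.IMCDivIntFrameAtErratumData W p) (d : ℤ) :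
    P2.IMCDivIntFrameAtDiscr W p d := by
  intro _ q _ K _ _ Dt H w₀ P hE hr hqp hmq hns hvq hK _hd hCas hP hc hinf κ hκ γ _ ι' e he
  exact h q K Dt H w₀ P hE hr hqp hmq hns hvq hK hCas hP hc hinf κ hκ γ ι' e he

/-- The with-value slices at all discriminants give the with-value shape. [folklore] -/
theorem P2.imcDivIntFrameAtErratumData_of_forall_atDiscr (h : ∀ d : ℤ, P2.IMCDivIntFrameAtDiscr W p d) :
    P2.IMCDivIntFrameAtErratumData W p := by
  intro _ q _ K _ _ Dt H w₀ P hE hr hqp hmq hns hvq hK hCas hP hc hinf κ hκ γ _ ι' e he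
  exact h (NumberField.discr K) q K Dt H w₀ P hE hr hqp hmq hns hvq hK rfl hCas hP hc hinf κ hκ γ ι' e he

/-- Forget the value conjunct, slice by slice. [folklore] -/
theorem P2.imcDivIntCoreFrameAtDiscr_of_imcDivIntFrameAtDiscr {d : ℤ} (h : P2.IMCDivIntFrameAtDiscr W p d) :
    P2.IMCDivIntCoreFrameAtDiscr W p d := by
  intro _ q _ K _ _ Dt H w₀ P hE hr hqp hmq hns hvq hK hd hCas hP hc hinf κ hκ γ _ ι' e he
  obtain ⟨ΩK, Ωp, Q, hΩ, hΩp, hQ, -, h3At⟩ :=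
    h q K Dt H w₀ P hE hr hqp hmq hns hvq hK hd hCas hP hc hinf κ hκ γ ι' e he
  exact ⟨ΩK, Ωp, Q, hΩ, hΩp, hQ, h3At⟩

end Slices

/-! ### §3 A slice from print + the unit-value certificate at that discriminant (semistable pairs) -/

section UnitCert

variable {W : WeierstrassCurve ℚ} [W.IsElliptic] [W.IsGloballyMinimal] {p : ℕ} [Fact p.Prime] {d : ℤ}

/-- **H3♭ WITH VALUE at discriminant `d` from Castella 2018 Thms. 3.1–3.2 + the unit-value certificate at `d`**, on a
SEMISTABLE pair: at each erratum datum over a field of discriminant `d` the certificate makes the datum a unit datum, and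
imc-p1 g5's `P2.imcDivIntFrameAtDatum_of_thm32_of_unitValue` gives a UNIT frame there (divisibility trivial, value from
print). CONDITIONAL on `h32` (PUBLISHED) and the ATTESTED certificate; nothing booked; one slice of the crux only.
[cite: Castella2018, Thm. 3.1, display (3.2) and Thm. 3.2 (arXiv:1704.06608 p. 9)] [cite: Castella2018Erratum, (2.4) (p. 4)] -/
theorem P2.imcDivIntFrameAtDiscr_of_thm32_of_unitCertAtDiscr
    (h32 : thm32_exists_isBDPLFunction_valueAtOne) (hss : Semistable W)
    (hunit : ∀ [NeZero (W.conductorNorm ℤ)] (q : ℕ) [Fact q.Prime] (K : Type) [Field K] [NumberField K]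
      (Dt : ModularParametrizationData W (W.conductorNorm ℤ))
      (H : HeegnerDatum (W.conductorNorm ℤ) (NumberField.discr K)) (w₀ : InfinitePlace K)
      (P : (W.baseChange K).toAffine.Point), ErratumHypotheses W p → W.analyticRank = 1 →
      q ≠ p → Mult W q → ¬ W.HasSplitMultiplicativeReductionAtPrime q →
      ¬ p ∣ padicValInt q W.minimalDiscriminantInt → IsErratumField W K q → NumberField.discr K = d →
      Cas20Standing K p (W.conductorNorm ℤ / p) →
      WeierstrassCurve.Affine.Point.map w₀.embedding.toRatAlgHom P = heegnerPointComplex Dt H →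
      ¬ (p : ℤ) ∣ Dt.c → ¬ IsOfFinAddOrder P →
      ∀ (κ : ZpExtension K p), κ.IsAnticyclotomic →
        ∀ (γ : Field.absoluteGaloisGroup K) [Fact (κ.IsTopGenerator γ)] (ι' : PadicAlgCl p ≃+* ℂ)
          (e : K →+* ℚ_[p]),
          (∀ k : 𝓞 K, k ∈ (primeOfEmbeddingDatum p ι' w₀.embedding).asIdeal ↔ ‖e (k : K)‖ < 1) →
          ‖((1 : ℚ_[p]) - (W.LFunction p : ℚ_[p]) * (p : ℚ_[p])⁻¹) * logOmega W p e P‖ = 1) :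
    P2.IMCDivIntFrameAtDiscr W p d := by
  intro _ q _ K _ _ Dt H w₀ P hE hr hqp hmq hns hvq hK hd hCas hP hc hinf κ hκ γ _ ι' e he
  exact P2.imcDivIntFrameAtDatum_of_thm32_of_unitValue h32 Dt H w₀ hE hss hqp hK hP hc κ hκ γ ι' he
    (hunit q K Dt H w₀ P hE hr hqp hmq hns hvq hK hd hCas hP hc hinf κ hκ γ ι' e he)

/-- **H3♭ CORE at discriminant `d` from Castella 2018 Thms. 3.1–3.2 + the unit-value certificate at `d`** (semistable
pair) — the statement of a per-discriminant rung of crux 19270, e.g. `stub_rung_imcDivErratum_5235a1_d231` at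
`(5235a1, 5, −231)`. CONDITIONAL on `h32` and the certificate; nothing booked; one slice only.
[cite: Castella2018, Thms. 3.1–3.2 (arXiv:1704.06608 p. 9)] [cite: Castella2018Erratum, (2.4) (p. 4)] -/
theorem P2.imcDivIntCoreFrameAtDiscr_of_thm32_of_unitCertAtDiscr
    (h32 : thm32_exists_isBDPLFunction_valueAtOne) (hss : Semistable W)
    (hunit : ∀ [NeZero (W.conductorNorm ℤ)] (q : ℕ) [Fact q.Prime] (K : Type) [Field K] [NumberField K]
      (Dt : ModularParametrizationData W (W.conductorNorm ℤ))
      (H : HeegnerDatum (W.conductorNorm ℤ) (NumberField.discr K)) (w₀ : InfinitePlace K)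
      (P : (W.baseChange K).toAffine.Point), ErratumHypotheses W p → W.analyticRank = 1 →
      q ≠ p → Mult W q → ¬ W.HasSplitMultiplicativeReductionAtPrime q →
      ¬ p ∣ padicValInt q W.minimalDiscriminantInt → IsErratumField W K q → NumberField.discr K = d →
      Cas20Standing K p (W.conductorNorm ℤ / p) →
      WeierstrassCurve.Affine.Point.map w₀.embedding.toRatAlgHom P = heegnerPointComplex Dt H →
      ¬ (p : ℤ) ∣ Dt.c → ¬ IsOfFinAddOrder P →
      ∀ (κ : ZpExtension K p), κ.IsAnticyclotomic →
        ∀ (γ : Field.absoluteGaloisGroup K) [Fact (κ.IsTopGenerator γ)] (ι' : PadicAlgCl p ≃+* ℂ)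
          (e : K →+* ℚ_[p]),
          (∀ k : 𝓞 K, k ∈ (primeOfEmbeddingDatum p ι' w₀.embedding).asIdeal ↔ ‖e (k : K)‖ < 1) →
          ‖((1 : ℚ_[p]) - (W.LFunction p : ℚ_[p]) * (p : ℚ_[p])⁻¹) * logOmega W p e P‖ = 1) :
    P2.IMCDivIntCoreFrameAtDiscr W p d :=
  P2.imcDivIntCoreFrameAtDiscr_of_imcDivIntFrameAtDiscr
    (P2.imcDivIntFrameAtDiscr_of_thm32_of_unitCertAtDiscr h32 hss hunit)

end UnitCert

end Summit.BirchSwinnertonDyer.Rank1Residual.X11b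

end
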